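import Summits.QuantumFields.YangMills.Theorems.BalabanLadderNTReferenceOneCube
import Summits.QuantumFields.YangMills.Theses.BalabanLadder
import HarnessLib

/-!
# Crux `NT` (stmt-QuantumFields-19353): reference-state transfer, XVIII — `LowerBounds` and `BalabanLadder.NT` BY NAME
# from the MINIMAL one-cube package

Helper file (`--supports stmt-QuantumFields-19353`) of the fleet lead prover of crux `NT` (unit `ym-spine-19353-p1`,
g4): the package-level form of `…NTReferenceOneCube.lean`.  For every compact simple `G`: one `(r, a)` (`0 < a`,
`a → 0`), a support radius `σ`, a femto scale `ℓ`, and, for each clause, test functions supported in the ball of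
radius `σ`, `ε > 0`, and for every large `β` ONE origin-centred femto cube `P_β` (radius `R β ≥ ⌈σ/aβ⌉₊ + 1`,
`(2Rβ+1)·aβ ≤ ℓ`), ONE torus `2L₀(β)+1` with `aβ·L₀(β) ≥ ℓ + 1`, ARBITRARY exterior-oscillation bounds `k β`,
`w β x y`, `ω₃ β x y z` for the one/two/three-point `P_β`-kernel data of the action density at the support-box sites,
and the floor with the matching margin on that torus.  Then `LowerBounds G r a` (`lowerBounds_of_oneCube`) and
`Summit.QuantumFields.YangMills.Theses.BalabanLadder.NT` (`nt_of_oneCubePackage`).  This is the weakest registered-shape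
text the reference-state transfer supports.  Relation to the skeleton of record v4T (`RefPkgT`): v4T's E1/E2/E3-osc and
transfer cube `⌈(σ+κ)/aβ⌉₊ + 1` supply `k, w, ω₃, R` (files VII–IX, XII); the only difference is the torus threshold —
here `Λ₅ = ℓ + 1` (any femto cube fits), in v4T `Λ₅ = σ + κ + 1` (the cube radius is pinned) — so the two texts are
parallel sufficient conditions for `NT`, neither a verbatim instance of the other.
-/

set_option autoImplicit false

noncomputable section

open scoped SchwartzMap
open MeasureTheory Filter Topology
open Literature.MathematicalPhysics.QuantumFieldTheory Literature.MathematicalPhysics.QuantumLattice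
open Literature.Probability.LatticeModels
open Summit.QuantumFields.YangMills.Cruxes.OSLegsFromFemtoAndGap.DlrCollarTransfer

namespace Summit.QuantumFields.YangMills.Cruxes.NT.Reference

section Package

variable (G : Type) [Group G] [TopologicalSpace G] [IsTopologicalGroup G] [CompactSpace G]
  [MeasurableSpace G] [BorelSpace G] (r : LatticeRep G)

/-- **`LowerBounds` from the minimal one-cube package.** [folklore] -/
theorem lowerBounds_of_oneCube (a : ℝ → ℝ) (ha₀ : ∀ β, 0 < a β) (ha : Tendsto a atTop (𝓝 0)) {σ ℓ : ℝ}
    (h2 : ∃ (v : 𝓢(EuclideanSpace ℝ (Fin 4), ℝ)) (ε β₅ : ℝ) (R L₀ : ℝ → ℕ) (k : ℝ → ℝ)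
      (w : ℝ → (Fin 4 → ℤ) → (Fin 4 → ℤ) → ℝ),
      tsupport (v : EuclideanSpace ℝ (Fin 4) → ℝ) ⊆ {y | 0 < y 0} ∧
      tsupport (v : EuclideanSpace ℝ (Fin 4) → ℝ) ⊆ Metric.closedBall 0 σ ∧ 0 < ε ∧
      ∀ β : ℝ, β₅ ≤ β → ⌈σ / a β⌉₊ + 1 ≤ R β ∧ ((2 * R β + 1 : ℕ) : ℝ) * a β ≤ ℓ ∧ ℓ + 1 ≤ a β * L₀ β ∧
      (∀ (ζ ζ' : LGConfig 4 G) (x : Fin 4 → ℤ), x ∈ box 4 ⌈σ / a β⌉₊ →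
        |kerE G r β (fun _ => -(R β : ℤ)) (2 * R β + 1) ζ (dens G r x) -
          kerE G r β (fun _ => -(R β : ℤ)) (2 * R β + 1) ζ' (dens G r x)| ≤ k β) ∧
      (∀ (ζ ζ' : LGConfig 4 G) (x y : Fin 4 → ℤ), x ∈ box 4 ⌈σ / a β⌉₊ → y ∈ box 4 ⌈σ / a β⌉₊ →
        |kerCov G r β (fun _ => -(R β : ℤ)) (2 * R β + 1) ζ (dens G r x) (dens G r y) -
          kerCov G r β (fun _ => -(R β : ℤ)) (2 * R β + 1) ζ' (dens G r x) (dens G r y)| ≤ w β x y) ∧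
      ε + ∑ x ∈ box 4 ⌈σ / a β⌉₊, ∑ y ∈ box 4 ⌈σ / a β⌉₊,
          |thetaTest 4 v (a β • siteToE x)| * |v (a β • siteToE y)| * (2 * k β * k β + w β x y) ≤
        Q2 G r β (L₀ β) (a β) (thetaTest 4 v) v)
    (h3 : ∃ (f g h : 𝓢(EuclideanSpace ℝ (Fin 4), ℝ)) (ε β₅ : ℝ) (R L₀ : ℝ → ℕ) (k : ℝ → ℝ)
      (w : ℝ → (Fin 4 → ℤ) → (Fin 4 → ℤ) → ℝ) (ω₃ : ℝ → (Fin 4 → ℤ) → (Fin 4 → ℤ) → (Fin 4 → ℤ) → ℝ),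
      Disjoint (tsupport (f : EuclideanSpace ℝ (Fin 4) → ℝ)) (tsupport (g : EuclideanSpace ℝ (Fin 4) → ℝ)) ∧
      Disjoint (tsupport (g : EuclideanSpace ℝ (Fin 4) → ℝ)) (tsupport (h : EuclideanSpace ℝ (Fin 4) → ℝ)) ∧
      Disjoint (tsupport (f : EuclideanSpace ℝ (Fin 4) → ℝ)) (tsupport (h : EuclideanSpace ℝ (Fin 4) → ℝ)) ∧
      tsupport (f : EuclideanSpace ℝ (Fin 4) → ℝ) ⊆ Metric.closedBall 0 σ ∧
      tsupport (g : EuclideanSpace ℝ (Fin 4) → ℝ) ⊆ Metric.closedBall 0 σ ∧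
      tsupport (h : EuclideanSpace ℝ (Fin 4) → ℝ) ⊆ Metric.closedBall 0 σ ∧ 0 < ε ∧
      ∀ β : ℝ, β₅ ≤ β → ⌈σ / a β⌉₊ + 1 ≤ R β ∧ ((2 * R β + 1 : ℕ) : ℝ) * a β ≤ ℓ ∧ ℓ + 1 ≤ a β * L₀ β ∧
      (∀ (ζ ζ' : LGConfig 4 G) (x : Fin 4 → ℤ), x ∈ box 4 ⌈σ / a β⌉₊ →
        |kerE G r β (fun _ => -(R β : ℤ)) (2 * R β + 1) ζ (dens G r x) -
          kerE G r β (fun _ => -(R β : ℤ)) (2 * R β + 1) ζ' (dens G r x)| ≤ k β) ∧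
      (∀ (ζ ζ' : LGConfig 4 G) (x y : Fin 4 → ℤ), x ∈ box 4 ⌈σ / a β⌉₊ → y ∈ box 4 ⌈σ / a β⌉₊ →
        |kerCov G r β (fun _ => -(R β : ℤ)) (2 * R β + 1) ζ (dens G r x) (dens G r y) -
          kerCov G r β (fun _ => -(R β : ℤ)) (2 * R β + 1) ζ' (dens G r x) (dens G r y)| ≤ w β x y) ∧
      (∀ (ζ ζ' : LGConfig 4 G) (x y z : Fin 4 → ℤ),
        x ∈ box 4 ⌈σ / a β⌉₊ → y ∈ box 4 ⌈σ / a β⌉₊ → z ∈ box 4 ⌈σ / a β⌉₊ →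
        |kerK3 G r β (fun _ => -(R β : ℤ)) (2 * R β + 1) ζ x y z -
          kerK3 G r β (fun _ => -(R β : ℤ)) (2 * R β + 1) ζ' x y z| ≤ ω₃ β x y z) ∧
      ε + ∑ x ∈ box 4 ⌈σ / a β⌉₊, ∑ y ∈ box 4 ⌈σ / a β⌉₊, ∑ z ∈ box 4 ⌈σ / a β⌉₊,
          |f (a β • siteToE x)| * |g (a β • siteToE y)| * |h (a β • siteToE z)| *
            (2 * (k β * w β y z + k β * w β x z + k β * w β x y + k β * k β * k β) + ω₃ β x y z) ≤
        |Q3 G r β (L₀ β) (a β) f g h|) :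
    LowerBounds G r a := by
  obtain ⟨v, ε, β₅, R, L₀, k, w, hvpos, hvσ, hε, H⟩ := h2
  obtain ⟨f, g, h, ε', β₅', R', L₀', k', w', ω₃, hfg, hgh, hfh, hfσ, hgσ, hhσ, hε', H'⟩ := h3
  obtain ⟨β₆, H2⟩ := q2_floor_of_oneCube G r a ha₀ ha v ε β₅ R L₀ k w hvσ H
  obtain ⟨β₇, H3⟩ := q3_floor_of_oneCube G r a ha₀ ha f g h ε' β₅' R' L₀' k' w' ω₃ hfσ hgσ hhσ H'
  exact ⟨⟨v, ε, β₆, ℓ + 1, hvpos, hε, H2⟩, ⟨f, g, h, ε', β₇, ℓ + 1, hfg, hgh, hfh, hε', H3⟩⟩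

end Package

/-- **The crux `BalabanLadder.NT` BY NAME from the minimal one-cube package** (see the module docstring). [folklore] -/
theorem nt_of_oneCubePackage
    (hP : ∀ (G : Type) [Group G] [TopologicalSpace G] [IsTopologicalGroup G] [CompactSpace G],
      IsCompactSimpleLieGroup G → letI : MeasurableSpace G := borel G; haveI : BorelSpace G := ⟨rfl⟩;
      ∃ (r : LatticeRep G) (a : ℝ → ℝ), (∀ β, 0 < a β) ∧ Tendsto a atTop (𝓝 0) ∧ ∃ (σ ℓ : ℝ),
      (∃ (v : 𝓢(EuclideanSpace ℝ (Fin 4), ℝ)) (ε β₅ : ℝ) (R L₀ : ℝ → ℕ) (k : ℝ → ℝ)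
        (w : ℝ → (Fin 4 → ℤ) → (Fin 4 → ℤ) → ℝ),
        tsupport (v : EuclideanSpace ℝ (Fin 4) → ℝ) ⊆ {y | 0 < y 0} ∧
        tsupport (v : EuclideanSpace ℝ (Fin 4) → ℝ) ⊆ Metric.closedBall 0 σ ∧ 0 < ε ∧
        ∀ β : ℝ, β₅ ≤ β → ⌈σ / a β⌉₊ + 1 ≤ R β ∧ ((2 * R β + 1 : ℕ) : ℝ) * a β ≤ ℓ ∧ ℓ + 1 ≤ a β * L₀ β ∧
        (∀ (ζ ζ' : LGConfig 4 G) (x : Fin 4 → ℤ), x ∈ box 4 ⌈σ / a β⌉₊ →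
          |kerE G r β (fun _ => -(R β : ℤ)) (2 * R β + 1) ζ (dens G r x) -
            kerE G r β (fun _ => -(R β : ℤ)) (2 * R β + 1) ζ' (dens G r x)| ≤ k β) ∧
        (∀ (ζ ζ' : LGConfig 4 G) (x y : Fin 4 → ℤ), x ∈ box 4 ⌈σ / a β⌉₊ → y ∈ box 4 ⌈σ / a β⌉₊ →
          |kerCov G r β (fun _ => -(R β : ℤ)) (2 * R β + 1) ζ (dens G r x) (dens G r y) -
            kerCov G r β (fun _ => -(R β : ℤ)) (2 * R β + 1) ζ' (dens G r x) (dens G r y)| ≤ w β x y) ∧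
        ε + ∑ x ∈ box 4 ⌈σ / a β⌉₊, ∑ y ∈ box 4 ⌈σ / a β⌉₊,
            |thetaTest 4 v (a β • siteToE x)| * |v (a β • siteToE y)| * (2 * k β * k β + w β x y) ≤
          Q2 G r β (L₀ β) (a β) (thetaTest 4 v) v) ∧
      (∃ (f g h : 𝓢(EuclideanSpace ℝ (Fin 4), ℝ)) (ε β₅ : ℝ) (R L₀ : ℝ → ℕ) (k : ℝ → ℝ)
        (w : ℝ → (Fin 4 → ℤ) → (Fin 4 → ℤ) → ℝ) (ω₃ : ℝ → (Fin 4 → ℤ) → (Fin 4 → ℤ) → (Fin 4 → ℤ) → ℝ),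
        Disjoint (tsupport (f : EuclideanSpace ℝ (Fin 4) → ℝ)) (tsupport (g : EuclideanSpace ℝ (Fin 4) → ℝ)) ∧
        Disjoint (tsupport (g : EuclideanSpace ℝ (Fin 4) → ℝ)) (tsupport (h : EuclideanSpace ℝ (Fin 4) → ℝ)) ∧
        Disjoint (tsupport (f : EuclideanSpace ℝ (Fin 4) → ℝ)) (tsupport (h : EuclideanSpace ℝ (Fin 4) → ℝ)) ∧
        tsupport (f : EuclideanSpace ℝ (Fin 4) → ℝ) ⊆ Metric.closedBall 0 σ ∧
        tsupport (g : EuclideanSpace ℝ (Fin 4) → ℝ) ⊆ Metric.closedBall 0 σ ∧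
        tsupport (h : EuclideanSpace ℝ (Fin 4) → ℝ) ⊆ Metric.closedBall 0 σ ∧ 0 < ε ∧
        ∀ β : ℝ, β₅ ≤ β → ⌈σ / a β⌉₊ + 1 ≤ R β ∧ ((2 * R β + 1 : ℕ) : ℝ) * a β ≤ ℓ ∧ ℓ + 1 ≤ a β * L₀ β ∧
        (∀ (ζ ζ' : LGConfig 4 G) (x : Fin 4 → ℤ), x ∈ box 4 ⌈σ / a β⌉₊ →
          |kerE G r β (fun _ => -(R β : ℤ)) (2 * R β + 1) ζ (dens G r x) -
            kerE G r β (fun _ => -(R β : ℤ)) (2 * R β + 1) ζ' (dens G r x)| ≤ k β) ∧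
        (∀ (ζ ζ' : LGConfig 4 G) (x y : Fin 4 → ℤ), x ∈ box 4 ⌈σ / a β⌉₊ → y ∈ box 4 ⌈σ / a β⌉₊ →
          |kerCov G r β (fun _ => -(R β : ℤ)) (2 * R β + 1) ζ (dens G r x) (dens G r y) -
            kerCov G r β (fun _ => -(R β : ℤ)) (2 * R β + 1) ζ' (dens G r x) (dens G r y)| ≤ w β x y) ∧
        (∀ (ζ ζ' : LGConfig 4 G) (x y z : Fin 4 → ℤ),
          x ∈ box 4 ⌈σ / a β⌉₊ → y ∈ box 4 ⌈σ / a β⌉₊ → z ∈ box 4 ⌈σ / a β⌉₊ →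
          |kerK3 G r β (fun _ => -(R β : ℤ)) (2 * R β + 1) ζ x y z -
            kerK3 G r β (fun _ => -(R β : ℤ)) (2 * R β + 1) ζ' x y z| ≤ ω₃ β x y z) ∧
        ε + ∑ x ∈ box 4 ⌈σ / a β⌉₊, ∑ y ∈ box 4 ⌈σ / a β⌉₊, ∑ z ∈ box 4 ⌈σ / a β⌉₊,
            |f (a β • siteToE x)| * |g (a β • siteToE y)| * |h (a β • siteToE z)| *
              (2 * (k β * w β y z + k β * w β x z + k β * w β x y + k β * k β * k β) + ω₃ β x y z) ≤
          |Q3 G r β (L₀ β) (a β) f g h|)) :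
    Summit.QuantumFields.YangMills.Theses.BalabanLadder.NT := by
  intro G _ _ _ _ hG
  letI : MeasurableSpace G := borel G
  haveI : BorelSpace G := ⟨rfl⟩
  obtain ⟨r, a, ha₀, ha, σ, ℓ, h2, h3⟩ := hP G hG
  exact ⟨r, a, ha₀, ha, lowerBounds_of_oneCube G r a ha₀ ha h2 h3⟩

end Summit.QuantumFields.YangMills.Cruxes.NT.Reference

end
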